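import Summits.ResolutionOfSingularities.ResolutionOfSingularities.Theorems.FrobeniusLadderFInjectiveMacaulayficationFTemkinClosedPointsGen
import HarnessLib

/-!
# F-TEMKIN AT THE CLOSED POINTS from a PER-VARIETY LOCAL HYPOTHESIS AT CLOSED SINGULAR POINTS — the dimension-free engine, and the (LF_cl) versions
# (crux `FInjectiveMacaulayfication` stmt-ResolutionOfSingularities-15315, chain w45a; res-L1-w45a-plan-1 RULING R17.6 (2) «(LF) ↦ (LF_cl)»;
# seat res-L1-w45a-stub-2 g6)

[OURS · L1 W4.5a] Support file (`--supports stmt-ResolutionOfSingularities-15315 --as helper`); NOT a statement of any manuscript; def-free; AI-written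
(AI review is weaker than expert review).

THE ENGINE `full_model_of_regularOffFinite_of_localClosed`. `X/k` integral separated of finite type (ANY dimension), `f : X′ → X` a blowing up with
`Supp J ⊆ Sing X`, REGULAR off the preimage of a finite set `F` of closed points. HYPOTHESIS `hloc`, about THIS `X` only: at every CLOSED SINGULAR point
`b`, every blowing up `S′ → Spec 𝒪_{X,b}` along a non-zero centre that is regular off its closed fibre admits a fibre-supported centre `𝓚 ≠ ⊥` all of
whose blowings up are FULL at every point. CONCLUSION: a blowing up `X″ → X` along some `J″ ≠ ⊥`, `Supp J″ ⊆ Sing X`, FULL AT EVERY POINT. The proof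
is this seat's p586439/p587868 induction (Temkin 2008 Prop. 2.3.4 one more stage at the closed points: flat base change to `X′ ×_X Spec 𝒪_{X,b}`,
local centre, Lemma 2.1.1 extension supported in `f⁻¹(b)`, Stacks 080B composite, FULL over `b` by flat base change and pro-open stalk isomorphisms)
with the local statement consumed EXACTLY where it is used — at closed `b ∈ Sing X` — and NO dimension bookkeeping at all. Every global local
statement ((L4♭), (LF), (LF_cl), …) now enters through a one-line instantiation of `hloc`.
* `exists_isBlowup_full_of_LFclosed_of_regularOffFinite (hLFcl) … (hd : 4 ≤ dim X) (hA)` — the (LF_cl) version of p587868's corollary: (LF_cl)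
  (`LocalFullificationFibreClosedGe4`, spelled out) at `d := dim X` supplies `hloc` (a closed point of a `d`-fold has local dimension `d`,
  `FTemkinClosedPoints.ringKrullDim_stalk_eq_of_isClosed`); `hA` = THEOREM A-gen's output for `X` (res-L1-w45a-stub-3's `regularOffFinite_of_LR[fibre]`).
[folklore assembly; cite: Temkin2008, Prop. 2.3.4 and Lemma 2.1.1] [cite: StacksProject, Tag 080B; Tag 01J7]
-/

-- single-problem summit: the doubled namespace component is forced
set_option linter.dupNamespace false

noncomputable section

namespace Summit.ResolutionOfSingularities.ResolutionOfSingularities.Theorems.FInjectiveMacaulayfication.FTemkinClosedPointsLocal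

open CategoryTheory CategoryTheory.Limits AlgebraicGeometry TopologicalSpace IsLocalRing Order
open Literature.AlgebraicGeometry.Resolution
open Summit.ResolutionOfSingularities.ResolutionOfSingularities.Theorems.FInjectiveMacaulayfication
open SliceableCentre FTemkinClosedPoints

set_option maxHeartbeats 1600000 in
-- long: one Temkin step (flat base change, extension, composite) inside a Finset induction
/-- **F-Temkin at the closed points, dimension-free engine.** See the module docstring. [OURS] [cite: Temkin2008, Prop. 2.3.4 and Lemma 2.1.1]
[cite: StacksProject, Tag 080B] -/
theorem full_model_of_regularOffFinite_of_localClosed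
    (p : ℕ) (hp : p.Prime) (k : Type) [Field k] [CharP k p] (X : Scheme.{0}) (f₀ : X ⟶ Spec (.of k))
    [IsSeparated f₀] [LocallyOfFiniteType f₀] [QuasiCompact f₀] [IsIntegral X]
    (hloc : ∀ b : X, IsClosed ({b} : Set X) → b ∉ Scheme.regularLocus X →
      ∀ (S' : Scheme.{0}) (g : S' ⟶ Spec (X.presheaf.stalk b)) (I : (Spec (X.presheaf.stalk b)).IdealSheafData), I ≠ ⊥ → IsBlowup g I →
      (∀ s : S', g.base s ≠ IsLocalRing.closedPoint (X.presheaf.stalk b) → s ∈ Scheme.regularLocus S') →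
      ∃ 𝓚 : S'.IdealSheafData, 𝓚 ≠ ⊥ ∧ (∀ s ∈ (𝓚.support : Set S'), g.base s = IsLocalRing.closedPoint (X.presheaf.stalk b)) ∧
        ∀ (S'' : Scheme.{0}) (π : S'' ⟶ S'), IsBlowup π 𝓚 → ∀ s : S'', SliceableCentre.FullCl p (S''.presheaf.stalk s))
    (X' : Scheme.{0}) (f : X' ⟶ X) (J : X.IdealSheafData) (hf : IsBlowup f J)
    (hJ : (J.support : Set X) ⊆ (Scheme.regularLocus X)ᶜ)
    (F : Finset X) (hFcl : ∀ b ∈ F, IsClosed ({b} : Set X)) (hreg : ∀ x' : X', f x' ∉ F → IsRegularLocalRing (X'.presheaf.stalk x')) :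
    ∃ (X'' : Scheme.{0}) (f'' : X'' ⟶ X) (J'' : X.IdealSheafData), IsBlowup f'' J'' ∧ J'' ≠ ⊥ ∧
      (J''.support : Set X) ⊆ (Scheme.regularLocus X)ᶜ ∧ ∀ x'' : X'', FullCl p (X''.presheaf.stalk x'') := by
  classical
  haveI : Fact p.Prime := ⟨hp⟩
  haveI : IsLocallyNoetherian X := LocallyOfFiniteType.isLocallyNoetherian f₀
  haveI : CompactSpace X := QuasiCompact.compactSpace_of_compactSpace f₀
  haveI : IsNoetherian X := {}
  set T : Set X := (Scheme.regularLocus X)ᶜ with hT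
  -- `J ≠ ⊥` for every `T`-supported centre
  have hne_of_supp : ∀ J₁ : X.IdealSheafData, (J₁.support : Set X) ⊆ T → J₁ ≠ ⊥ := by
    intro J₁ hJ₁ h0
    have hgen : genericPoint X ∈ (J₁.support : Set X) := by rw [h0, Scheme.IdealSheafData.support_bot]; trivial
    have := hJ₁ hgen
    rw [hT, Set.mem_compl_iff, Scheme.mem_regularLocus] at this
    exact this (inferInstanceAs (IsRegularLocalRing X.functionField))
  -- the induction on the set `U` of untreated closed points
  suffices H : ∀ U : Finset X, (∀ b ∈ U, IsClosed ({b} : Set X)) →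
      ∀ (X' : Scheme.{0}) (f : X' ⟶ X) (J : X.IdealSheafData), IsBlowup f J → (J.support : Set X) ⊆ T →
        (∀ x' : X', ¬ IsClosed ({f x'} : Set X) → IsRegularLocalRing (X'.presheaf.stalk x')) →
        (∀ x' : X', f x' ∉ U → FullCl p (X'.presheaf.stalk x')) →
        ∃ (X'' : Scheme.{0}) (f'' : X'' ⟶ X) (J'' : X.IdealSheafData), IsBlowup f'' J'' ∧ J'' ≠ ⊥ ∧
          (J''.support : Set X) ⊆ (Scheme.regularLocus X)ᶜ ∧ ∀ x'' : X'', FullCl p (X''.presheaf.stalk x'') by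
    refine H F hFcl X' f J hf hJ (fun x' hx' => hreg x' fun h => hx' (hFcl _ h)) fun x' hx' => ?_
    haveI := hreg x' hx'
    haveI := charP_stalk_of_over p f₀ f x'
    exact fullCl_of_isRegularLocalRing p _
  intro U
  induction U using Finset.induction with
  | empty =>
    intro _ X' f J hf hJ _ hfull
    exact ⟨X', f, J, hf, hne_of_supp J hJ, hJ, fun x' => hfull x' (by simp)⟩
  | insert b U hbU ih =>
    intro hcl X' f J hf hJ hregnc hfull
    have hb : IsClosed ({b} : Set X) := hcl b (Finset.mem_insert_self b U)
    have hclU : ∀ b' ∈ U, IsClosed ({b'} : Set X) := fun b' hb' => hcl b' (Finset.mem_insert_of_mem hb')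
    have hJne : J ≠ ⊥ := hne_of_supp J hJ
    haveI : IsProper f := hf.isProper
    haveI : IsLocallyNoetherian X' := LocallyOfFiniteType.isLocallyNoetherian f
    haveI : CompactSpace X' := QuasiCompact.compactSpace_of_compactSpace f
    haveI : IsNoetherian X' := {}
    haveI : IsIntegral X' := hf.isIntegral hJne
    by_cases hbT : b ∉ T
    · -- `b ∈ Reg X`: `f` is an isomorphism over `(Supp J)ᶜ ∋ b`, so `X'` is regular, hence FULL, over `b` — nothing to do
      refine ih hclU X' f J hf hJ hregnc fun x' hx' => ?_
      by_cases hxb : f x' = b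
      · have h2 : f x' ∉ (J.support : Set X) := fun h => hbT (hJ (hxb ▸ h))
        haveI := hf.isIso_compl
        have h1 : f x' ∈ Scheme.regularLocus X := by
          rw [hxb]; by_contra h; exact hbT h
        have hx'reg : x' ∈ Scheme.regularLocus X' :=
          (mem_regularLocus_iff_of_isIso_morphismRestrict f ⟨(J.support : Set X)ᶜ, J.support.isClosed.isOpen_compl⟩ x' h2).mpr h1
        rw [Scheme.mem_regularLocus] at hx'reg
        haveI := hx'reg
        haveI := charP_stalk_of_over p f₀ f x'
        exact fullCl_of_isRegularLocalRing p _
      · exact hfull x' (by simp [hxb, hx'])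
    -- `b ∈ Sing X`, a closed point
    push Not at hbT
    -- the pro-open local scheme `S' = X' ×_X Spec 𝒪_{X,b}`, a blowing up of `Spec 𝒪_{X,b}` (flat base change)
    haveI : Flat (X.fromSpecStalk b) := flat_fromSpecStalk X b
    haveI : IsNoetherian (pullback f (X.fromSpecStalk b)) := {}
    have hgb : IsBlowup (pullback.snd f (X.fromSpecStalk b)) (J.comap (X.fromSpecStalk b)) :=
      hf.pullback_snd_of_flat (X.fromSpecStalk b)
    have hfj : ∀ s : ↑(pullback f (X.fromSpecStalk b)),
        f (pullback.fst f (X.fromSpecStalk b) s) = X.fromSpecStalk b (pullback.snd f (X.fromSpecStalk b) s) := fun s => by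
      rw [← Scheme.Hom.comp_apply, pullback.condition, Scheme.Hom.comp_apply]
    have hJb : J.comap (X.fromSpecStalk b) ≠ ⊥ := by
      rw [comap_fromSpecStalk_eq_affineBlowupIdealSheaf]
      exact affineBlowup.idealSheaf_ne_bot (stalkIdeal_ne_bot_of_ne_bot hJne b)
    -- `S'` is regular off the closed fibre: its other points lie over NON-closed generizations of `b`
    have hregS' : ∀ s : ↑(pullback f (X.fromSpecStalk b)),
        (pullback.snd f (X.fromSpecStalk b)).base s ≠ closedPoint (X.presheaf.stalk b) →
          s ∈ Scheme.regularLocus (pullback f (X.fromSpecStalk b)) := by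
      intro s hs
      rw [mem_regularLocus_iff_pullback_fst_fromSpecStalk f b s, Scheme.mem_regularLocus]
      apply hregnc
      have hyb : f (pullback.fst f (X.fromSpecStalk b) s) ⤳ b := by
        have := Set.mem_range_self (f := pullback.fst f (X.fromSpecStalk b)) s
        rw [range_pullback_fst_fromSpecStalk] at this
        exact this
      refine not_isClosed_of_specializes_of_ne hyb fun heq => hs ?_
      apply (X.fromSpecStalk b).isEmbedding.injective
      rw [← hfj s, heq, Scheme.fromSpecStalk_closedPoint]
    -- the local hypothesis at the closed singular point `b`
    obtain ⟨𝓚, h𝓚ne, h𝓚fib, h𝓚full⟩ := hloc b hb hbT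
      (pullback f (X.fromSpecStalk b)) (pullback.snd f (X.fromSpecStalk b)) (J.comap (X.fromSpecStalk b)) hJb hgb hregS'
    -- extend the centre to `X'` (Lemma 2.1.1) and blow `X'` up along the extension
    obtain ⟨J', hJ'𝓚, hJ'supp⟩ := exists_idealSheaf_extension_fromSpecStalk f b 𝓚
    obtain ⟨X'', f', hf'⟩ := exists_isBlowup X' J'
    -- the new centre lies over `b` — from the fibre clause of `hloc`
    have h𝓚b : ∀ s ∈ (𝓚.support : Set ↑(pullback f (X.fromSpecStalk b))), f (pullback.fst f (X.fromSpecStalk b) s) = b := by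
      intro s hs
      rw [hfj s, h𝓚fib s hs, Scheme.fromSpecStalk_closedPoint]
    have hJ'b : f '' (J'.support : Set X') ⊆ {b} := by
      rw [hJ'supp]
      refine (image_closure_subset_closure_image f.continuous).trans ?_
      refine hb.closure_subset_iff.mpr ?_
      rintro _ ⟨_, ⟨s, hs, rfl⟩, rfl⟩
      exact h𝓚b s hs
    have hJ'T : (J'.support : Set X') ⊆ f ⁻¹' T := fun x' hx' => by
      have : f x' = b := hJ'b ⟨x', hx', rfl⟩
      show f x' ∈ T
      rw [this]; exact hbT
    -- so the composite is a `T`-supported blow-up of `X` (Lemma 2.1.4 / Stacks 080B)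
    obtain ⟨J₂, hf₂, hJ₂⟩ := hf.exists_isBlowup_comp_supported f J f' J' T hJ hf' hJ'T
    haveI : IsProper f' := hf'.isProper
    -- apply the induction hypothesis to the new model
    refine ih hclU X'' (f' ≫ f) J₂ hf₂ hJ₂ (fun x'' hx'' => ?_) (fun x'' hx'' => ?_)
    · -- regular over NON-closed points: there `f'` is an isomorphism (the centre lies over the closed point `b`)
      rw [Scheme.Hom.comp_apply] at hx''
      have h2 : f' x'' ∉ (J'.support : Set X') := fun h => by
        have : f (f' x'') = b := hJ'b ⟨_, h, rfl⟩
        exact hx'' (this ▸ hb)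
      haveI := hf'.isIso_compl
      have h1 : f' x'' ∈ Scheme.regularLocus X' := (Scheme.mem_regularLocus _).mpr (hregnc _ hx'')
      exact (Scheme.mem_regularLocus _).mp
        ((mem_regularLocus_iff_of_isIso_morphismRestrict f' ⟨(J'.support : Set X')ᶜ, J'.support.isClosed.isOpen_compl⟩ x'' h2).mpr h1)
    · rw [Scheme.Hom.comp_apply] at hx''
      by_cases hxb : f (f' x'') = b
      · -- over `b`: `X'' ×_{X'} S'` is a blowing up of `S'` along `𝓚`, FULL at every point; pro-open stalk isomorphisms
        have hs : f' x'' ∈ Set.range (pullback.fst f (X.fromSpecStalk b)) := mem_range_pullback_fst_fromSpecStalk_of_eq f b hxb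
        have hT'' : IsBlowup (pullback.snd f' (pullback.fst f (X.fromSpecStalk b))) 𝓚 := by
          rw [← hJ'𝓚]
          exact hf'.pullback_snd_of_flat _
        have hx''range : x'' ∈ Set.range (pullback.fst f' (pullback.fst f (X.fromSpecStalk b))) := by
          rw [Scheme.Pullback.range_fst]
          exact hs
        obtain ⟨t, rfl⟩ := hx''range
        have ht : FullCl p ((pullback f' (pullback.fst f (X.fromSpecStalk b))).presheaf.stalk t) := h𝓚full _ _ hT'' t
        haveI := isIso_stalkMap_of_flat_of_isPreimmersion (pullback.fst f' (pullback.fst f (X.fromSpecStalk b))) t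
        exact fullCl_of_isIso_stalkMap p _ t ht
      · -- elsewhere: `f'` is an isomorphism near `x''`, and `X'` was FULL there
        have h2 : f' x'' ∉ (J'.support : Set X') := fun h => hxb (hJ'b ⟨_, h, rfl⟩)
        haveI := hf'.isIso_compl
        haveI := isIso_stalkMap_of_isIso_morphismRestrict f' ⟨(J'.support : Set X')ᶜ, J'.support.isClosed.isOpen_compl⟩ x'' h2
        have hx'U : f (f' x'') ∉ insert b U := by simp [hxb, hx'']
        exact fullCl_of_isIso_stalkMap' p f' x'' (hfull (f' x'') (by simpa using hx'U))

/-- **The (LF_cl) version of `FTemkinClosedPointsGen.exists_isBlowup_full_of_LF_of_regularOffFinite`**: every integral variety of dimension `≥ 4` has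
a `Sing X`-supported blow-up model FULL at every point, modulo (LF_cl) (`LocalFullificationFibreClosedGe4`, spelled out: (LF) at CLOSED points only)
and THEOREM A-gen's output `hA` for `X`. [OURS · conditional-result] [cite: Temkin2008, Prop. 2.3.4] -/
theorem exists_isBlowup_full_of_LFclosed_of_regularOffFinite
    (hLF : ∀ d : ℕ, 4 ≤ d → ∀ (p : ℕ), p.Prime → ∀ (k : Type) [Field k] [CharP k p] (X : Scheme.{0}) (f : X ⟶ Spec (.of k)),
      IsSeparated f → LocallyOfFiniteType f → QuasiCompact f → IsIntegral X → ∀ x : X, IsClosed ({x} : Set X) →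
      ringKrullDim (X.presheaf.stalk x) = d →
      ∀ (S' : Scheme.{0}) (g : S' ⟶ Spec (X.presheaf.stalk x)) (I : (Spec (X.presheaf.stalk x)).IdealSheafData), I ≠ ⊥ → IsBlowup g I →
      (∀ s : S', g.base s ≠ IsLocalRing.closedPoint (X.presheaf.stalk x) → s ∈ Scheme.regularLocus S') →
      ∃ 𝓚 : S'.IdealSheafData, 𝓚 ≠ ⊥ ∧ (∀ s ∈ (𝓚.support : Set S'), g.base s = IsLocalRing.closedPoint (X.presheaf.stalk x)) ∧
        ∀ (S'' : Scheme.{0}) (π : S'' ⟶ S'), IsBlowup π 𝓚 → ∀ s : S'', SliceableCentre.FullCl p (S''.presheaf.stalk s))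
    (p : ℕ) (hp : p.Prime) (k : Type) [Field k] [CharP k p] (X : Scheme.{0}) (f₀ : X ⟶ Spec (.of k))
    [IsSeparated f₀] [LocallyOfFiniteType f₀] [QuasiCompact f₀] [IsIntegral X] (hd : (4 : WithBot ℕ∞) ≤ topologicalKrullDim X)
    (hA : ∃ (X' : Scheme.{0}) (f : X' ⟶ X) (J : X.IdealSheafData) (F : Set X), IsBlowup f J ∧
      (J.support : Set X) ⊆ (Scheme.regularLocus X)ᶜ ∧ IsClosed F ∧ F.Finite ∧ (∀ b ∈ F, IsClosed ({b} : Set X)) ∧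
      ∀ x' : X', f x' ∉ F → x' ∈ Scheme.regularLocus X') :
    ∃ (X'' : Scheme.{0}) (f'' : X'' ⟶ X) (J'' : X.IdealSheafData), IsBlowup f'' J'' ∧ J'' ≠ ⊥ ∧
      (J''.support : Set X) ⊆ (Scheme.regularLocus X)ᶜ ∧ ∀ x'' : X'', FullCl p (X''.presheaf.stalk x'') := by
  classical
  obtain ⟨X', f, J, F, hf, hJ, -, hFfin, hFcl, hreg⟩ := hA
  -- `X` is finite-dimensional: `dim X = d` for some natural `d ≥ 4`
  haveI : CompactSpace X := QuasiCompact.compactSpace_of_compactSpace f₀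
  obtain ⟨n, hn⟩ := exists_topologicalKrullDim_le_of_locallyOfFiniteType f₀
  obtain ⟨d, hd4, hdX⟩ : ∃ d : ℕ, 4 ≤ d ∧ topologicalKrullDim X = d := by
    induction hD : topologicalKrullDim X using WithBot.recBotCoe with
    | bot => rw [hD] at hd; exact absurd hd (by simp)
    | coe a =>
      rw [hD] at hd hn
      induction a using ENat.recTopCoe with
      | top => exact absurd (WithBot.coe_le_coe.mp hn) (by simp)
      | coe m => exact ⟨m, by exact_mod_cast (WithBot.coe_le_coe.mp hd), rfl⟩
  refine full_model_of_regularOffFinite_of_localClosed p hp k X f₀ (fun b hb _ => ?_) X' f J hf hJ hFfin.toFinset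
    (fun b hb => hFcl b (hFfin.mem_toFinset.mp hb))
    fun x' hx' => (Scheme.mem_regularLocus _).mp (hreg x' fun h => hx' (hFfin.mem_toFinset.mpr h))
  -- (LF_cl) at the closed point `b`, of local dimension `d = dim X`
  exact hLF d hd4 p hp k X f₀ inferInstance inferInstance inferInstance inferInstance b hb (ringKrullDim_stalk_eq_of_isClosed f₀ hdX b hb)

end Summit.ResolutionOfSingularities.ResolutionOfSingularities.Theorems.FInjectiveMacaulayfication.FTemkinClosedPointsLocal

end
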